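import Literature.NumberTheory.GaloisRepresentations.CyclicQuotientTwoCocycle
import Literature.NumberTheory.GaloisRepresentations.FiniteCoefficients
import Literature.NumberTheory.GaloisRepresentations.CohomologicalDimensionCriterion
import Literature.NumberTheory.GaloisRepresentations.ProfiniteIntersectionCocycleExtension
import HarnessLib

/-!
# `cd_p(Q) ≤ 1` for a procyclic profinite group with a topological generator (Serre CG I §3.4)

Topic `NumberTheory/GaloisRepresentations`; namespace `Literature.NumberTheory.GaloisRepresentations`.
Theorems only (no definition, no named fact; D-0026).

Let `Q` be a profinite group (compact, totally disconnected topological group) and `φ ∈ Q` an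
element whose image generates every finite quotient `Q/H` (`H` open normal) — a **topological
generator** — and assume that the open normal subgroups go arbitrarily deep *in the `p`-direction
along `φ`*: for every open normal `H₀` and every `s` there is an open normal `H₁ ≤ H₀` such that
`φ^i ∈ H₁` forces `p^s · ord(φ mod H₀) ∣ i` (e.g. `Q ≅ ℤ_p`, `Q ≅ ẑ`, or any procyclic group whose
pro-`p` part is infinite).  Then:

* `subsingleton_two_of_procyclic` — **`H²(Q, B) = 0`** for every finite discrete `p`-primary
  `Q`-module `B`;
* `groupCdLE_one_of_procyclic` — **`cd_p(Q) ≤ 1`** (`GroupCdLE Q p 1`).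

This is the computation "`cd(ẑ) = 1`" / "`cd_p(ℤ_p) = 1`" (Serre, *Cohomologie galoisienne* I §3.4,
II §3.3 ex.; *Corps locaux* XIII §1) in the form used by the tree: it is VERBATIM the argument of
`LocalFieldCdTwo.subsingleton_two_quotient_galUnr_of_finite` (there `Q = Γ_F/Gal(F̄/F^nr) ≅ ẑ`, the
Frobenius, and the deeper level built from the unramified extension `F_m`), with the deeper level
now supplied by the hypothesis `hdepth`: a continuous `2`-cocycle with finite `p`-primary
coefficients is inflated from a finite cyclic quotient `Q/H₀ = ⟨φ̄⟩` on which `B` is trivial, and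
dies after inflation to `Q/H₁` because the norm sum over one period vanishes
(`frobSum_eq_zero_of_dvd`, explicit coboundary `twoCocycleClass_eq_zero_of_cyclicQuotient`).
Consumer: the top step `cd_p(Gal(k_∞/k)) ≤ 1` of Serre II §4.4 Prop. 13 (`cd_p(G_k) ≤ 2` for number
fields, the tree's named fact `fieldCdLE_two_of_numberField`), `k_∞/k` the cyclotomic
`ℤ_p`-extension.

## References

* J.-P. Serre, *Cohomologie galoisienne* / *Galois Cohomology* (1997), I §3.4 (cohomology of
  procyclic groups), II §4.3 Prop. 12 (proof), II §4.4 Prop. 13 (proof). [SerreGaloisCohomology1997]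
* J.-P. Serre, *Corps locaux* (1968), XIII §1. [SerreLocalFields1979]
-/

noncomputable section

open CategoryTheory Function
open _root_.Topology _root_.Filter

universe u

namespace Literature.NumberTheory.GaloisRepresentations

open _root_.TopRep _root_.ContRepresentation _root_.ContinuousCohomology

section Procyclic

variable {Q : Type u} [Group Q] [TopologicalSpace Q] [IsTopologicalGroup Q] [CompactSpace Q]
  [TotallyDisconnectedSpace Q]

/-- **`H²(Q, B) = 0` for a procyclic profinite `Q` with topological generator `φ` and finite
discrete `p`-primary `B`**, provided the open normal subgroups of `Q` go arbitrarily deep in the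
`p`-direction along `φ` (`hdepth`).  Verbatim the argument of
`subsingleton_two_quotient_galUnr_of_finite` (`cd(ẑ) = 1`): the cocycle is inflated from a finite
cyclic level `Q/H₀ = ⟨φ̄⟩` acting trivially on `B`, and at a deeper level `H₁` the norm sum over one
period is a multiple of `p^e · (norm over a period mod H₀)` with `p^e B = 0`, so the explicit
coboundary of `CyclicQuotientTwoCocycle` applies.
[cite: SerreGaloisCohomology1997, I §3.4; II §4.3 Prop. 12 (proof)] [cite: SerreLocalFields1979, XIII §1] -/
theorem subsingleton_two_of_procyclic (φ : Q)
    (hgen : ∀ (H : Subgroup Q) [H.Normal], IsOpen (H : Set Q) →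
      ∀ q : Q ⧸ H, ∃ i : ℕ, q = (QuotientGroup.mk φ : Q ⧸ H) ^ i)
    {p : ℕ}
    (hdepth : ∀ (H : Subgroup Q) [H.Normal], IsOpen (H : Set Q) → ∀ s : ℕ,
      ∃ H' : Subgroup Q, H'.Normal ∧ IsOpen (H' : Set Q) ∧ H' ≤ H ∧
        ∀ i : ℕ, φ ^ i ∈ H' → p ^ s * orderOf (QuotientGroup.mk φ : Q ⧸ H) ∣ i)
    (B : Type u) [AddCommGroup B] [TopologicalSpace B] [DiscreteTopology B] [Finite B]
    (τ : ContinuousRep Q ℤ B) (hB : IsPrimaryTorsion p B) :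
    Subsingleton (continuousCohomology 2 τ.toTopRep) := by
  classical
  refine subsingleton_of_forall_eq 0 fun x => ?_
  obtain ⟨z, rfl⟩ := twoCocycleClass_surjective _ x
  -- the (open) kernel of the action
  have hker : (⋂ b : B, {σ : Q | τ σ b = b}) ∈ 𝓝 (1 : Q) :=
    (Filter.iInter_mem).2 fun b => τ.setOf_apply_eq_mem_nhds_one b
  -- uniform local constancy of `z` on `Q × Q`
  obtain ⟨V, hV, hVz⟩ := exists_nhds_one_forall_eq' (X := Q × Q) (P := Q × Q)
    (fun a v => z.1 (a.1 * v.1, a.2 * v.2))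
    (z.1.continuous.comp
      ((continuous_fst.fst.mul continuous_snd.fst).prodMk (continuous_fst.snd.mul continuous_snd.snd)))
  obtain ⟨V₁, hV₁, V₂, hV₂, hV₁₂⟩ := mem_nhds_prod_iff.1 hV
  have h1 : (1 : Q) ∈ interior ((⋂ b : B, {σ : Q | τ σ b = b}) ∩ (V₁ ∩ V₂)) :=
    mem_interior_iff_mem_nhds.2 (inter_mem hker (inter_mem hV₁ hV₂))
  obtain ⟨W, hW⟩ := ProfiniteGrp.exist_openNormalSubgroup_sub_open_nhds_of_one isOpen_interior h1
  have hW' : (W : Set Q) ⊆ (⋂ b : B, {σ | τ σ b = b}) ∩ (V₁ ∩ V₂) := hW.trans interior_subset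
  have h1V₁ : (1 : Q) ∈ V₁ := mem_of_mem_nhds hV₁
  have h1V₂ : (1 : Q) ∈ V₂ := mem_of_mem_nhds hV₂
  -- the open normal subgroup `H₀ = W`
  let H₀ : Subgroup Q := W
  haveI : H₀.Normal := W.isNormal'
  have hH₀o : IsOpen (H₀ : Set Q) := W.isOpen'
  -- right invariance of `z` and triviality of the action on `H₀`
  have hz₁ : ∀ (a b : Q), ∀ h ∈ H₀, z.1 (a * h, b) = z.1 (a, b) := by
    intro a b h hh
    have hmem : ((h, 1) : Q × Q) ∈ V := hV₁₂ (Set.mk_mem_prod (hW' hh).2.1 h1V₂)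
    have h := hVz (a, b) (h, 1) hmem
    dsimp only at h
    rw [mul_one, Prod.fst_one, Prod.snd_one, mul_one, mul_one] at h
    exact h
  have hz₂ : ∀ (a b : Q), ∀ h ∈ H₀, z.1 (a, b * h) = z.1 (a, b) := by
    intro a b h hh
    have hmem : ((1, h) : Q × Q) ∈ V := hV₁₂ (Set.mk_mem_prod h1V₁ (hW' hh).2.2)
    have h := hVz (a, b) (1, h) hmem
    dsimp only at h
    rw [mul_one, Prod.fst_one, Prod.snd_one, mul_one, mul_one] at h
    exact h
  have hHX : ∀ h ∈ H₀, ∀ b : B, τ.toTopRep.ρ h b = b := by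
    intro h hh b
    rw [ContinuousRep.toTopRep_ρ_apply]
    exact Set.mem_iInter.1 (hW' hh).1 b
  -- the period `n₀` of `φ` modulo `H₀`
  haveI : Finite (Q ⧸ H₀) := Subgroup.quotient_finite_of_isOpen H₀ hH₀o
  set n₀ : ℕ := orderOf (QuotientGroup.mk φ : Q ⧸ H₀) with hn₀
  have hn₀pos : 0 < n₀ := orderOf_pos _
  have hφn₀ : φ ^ n₀ ∈ H₀ := by
    rw [← QuotientGroup.eq_one_iff, QuotientGroup.mk_pow, hn₀]
    exact pow_orderOf_eq_one _
  -- a power `p^e` killing `B`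
  haveI := Fintype.ofFinite B
  choose k hk using hB
  set e : ℕ := Finset.univ.sum k with hedef
  have hkill : ∀ b : B, p ^ e • b = 0 := fun b => by
    have hle : k b ≤ e := Finset.single_le_sum (fun _ _ => Nat.zero_le _) (Finset.mem_univ b)
    rw [← pow_mul_pow_sub p hle, mul_comm, mul_smul, hk b, smul_zero]
  -- the deeper level `H₁`
  obtain ⟨H₁, hH₁n, hH₁o, hH₁₀, hdiv⟩ := hdepth H₀ hH₀o e
  haveI : H₁.Normal := hH₁n
  haveI : Finite (Q ⧸ H₁) := Subgroup.quotient_finite_of_isOpen H₁ hH₁o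
  set n₁ : ℕ := orderOf (QuotientGroup.mk φ : Q ⧸ H₁) with hn₁
  have hpow₁ : φ ^ n₁ ∈ H₁ := by
    rw [← QuotientGroup.eq_one_iff, QuotientGroup.mk_pow, hn₁]
    exact pow_orderOf_eq_one _
  have hdvd : p ^ e * n₀ ∣ n₁ := hdiv n₁ hpow₁
  obtain ⟨j, hj⟩ : n₀ ∣ n₁ := (Dvd.intro_left _ rfl : n₀ ∣ p ^ e * n₀).trans hdvd
  have hNk : p ^ e ∣ j := by
    have h := hdvd
    rw [hj, mul_comm (p ^ e) n₀] at h
    exact Nat.dvd_of_mul_dvd_mul_left hn₀pos h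
  -- the norm sum over one period modulo `H₁` vanishes
  have hsum : frobSum z φ (orderOf (QuotientGroup.mk φ : Q ⧸ H₁)) = 0 := by
    rw [← hn₁, hj]
    exact frobSum_eq_zero_of_dvd (H₀ := H₀) hz₁ hφn₀ (fun b : B => hkill b) hNk
  -- conclude with the explicit coboundary of `CyclicQuotientTwoCocycle`
  exact twoCocycleClass_eq_zero_of_cyclicQuotient H₁ φ z (hgen H₁ hH₁o) hH₁o
    (fun a b h hh => hz₁ a b h (hH₁₀ hh)) (fun a b h hh => hz₂ a b h (hH₁₀ hh))
    (fun h hh b => hHX h (hH₁₀ hh) b) hsum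

/-- **`cd_p(Q) ≤ 1` for a procyclic profinite group `Q` with a topological generator `φ`** whose
open normal subgroups go arbitrarily deep in the `p`-direction along `φ` (`hdepth`; e.g.
`Q ≅ ℤ_p`, `Q ≅ ẑ`): by Serre I §3.1 Prop. 11 (`groupCdLE_one_of_forall_subsingleton_two`) and the
reduction to finite coefficients (`subsingleton_of_forall_finite`) it suffices that `H²(Q, B) = 0`
for finite `p`-primary `B`, which is `subsingleton_two_of_procyclic`.
[cite: SerreGaloisCohomology1997, I §3.4; II §4.3 Prop. 12 (proof: `cd(ẑ) = 1`)] -/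
theorem groupCdLE_one_of_procyclic (φ : Q)
    (hgen : ∀ (H : Subgroup Q) [H.Normal], IsOpen (H : Set Q) →
      ∀ q : Q ⧸ H, ∃ i : ℕ, q = (QuotientGroup.mk φ : Q ⧸ H) ^ i)
    (p : ℕ) [hp : Fact p.Prime]
    (hdepth : ∀ (H : Subgroup Q) [H.Normal], IsOpen (H : Set Q) → ∀ s : ℕ,
      ∃ H' : Subgroup Q, H'.Normal ∧ IsOpen (H' : Set Q) ∧ H' ≤ H ∧
        ∀ i : ℕ, φ ^ i ∈ H' → p ^ s * orderOf (QuotientGroup.mk φ : Q ⧸ H) ∣ i) :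
    GroupCdLE Q p 1 :=
  groupCdLE_one_of_forall_subsingleton_two fun _ _ _ _ ρ hM =>
    subsingleton_of_forall_finite ρ hp.out.ne_zero 1
      (fun B _ _ _ _ τ hB' => subsingleton_two_of_procyclic φ hgen hdepth B τ hB') hM

end Procyclic

end Literature.NumberTheory.GaloisRepresentations

end
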